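import Mathlib
import HarnessLib
import Summits.HubbardSuperconductivity.HubbardSuperconductivity.Theorems.KLProgrammeKLRegimeEngineV8TowerExports2
import Summits.HubbardSuperconductivity.HubbardSuperconductivity.Theorems.KLProgrammeKLRegimeEngineV8ExportUnroll

/-!
# Skeleton v2 of `KLRegimeEngineV17F2` (stmt-HubbardSuperconductivity-20437), shape of record «∃-UNROLL» (plan g19 (R57), sheet rev 1.3 §K):
# the GENERIC strong-induction unroll and the CLASS-#1 SUCCESSOR twins (cell gate-hubbard-kl, seat p1b g10 — 20437 registrant lineage)

Companion of `…EngineV8ExportUnroll` (p550604) for the (R55c)/J1 successor shape of the export classes.  Under (R57) the v2 composition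
`KLRegimeEngineV17F2_of` produces NO export itself: ONE stub (X) `stub_engine_exports` carries the producers' ∃-deliverables, and the composition
UNROLLS them along the scale ladder — at scale `n ≤ n_β + 1`, with only the public history `HistP klPredsV17F2 … 0 n` in hand, the exports at EVERY
`j ≤ n`.  This module supplies:

* §0 **`exports_all_of_step`** — the generic unroll (K2 «cheapest form of the twins»; text = plan g19's v2x prerender §0, sha16 c4a2f5454b17e88b, credited):
  a one-step statement `∀ n ≤ N, (∀ j < n, E j) → E n` gives `∀ n ≤ N, ∀ j ≤ n, E j`; and the two-history variant **`exports_all_of_step₂`** (classes #5/#6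
  read the class-#1 exports at `j ≤ n` AND their own history at `j < n`).
* §1 **CLASS #1, SUCCESSOR SHAPE** (`LevelsUStep2 P R Q₀ c u`, …EngineV8TowerExports2, p552091 — binders `∀ G, G.WF → ∀ Q, Q₀.IsRaiseOf Q → …`, door
  `U ≤ klEngU₀10 P R cc`, CE-aware threshold `U ≤ u Q cc`, volume `klEngL₄ P R β U ≤ L`, history `HistP klPredsV17F2 L M G P Q R β U μ 0 n`, merged exports
  `LevelsUExportMixedAt`): **`levelsUExportMixedAt_all_of_step2`** (from the step and the binders, the public history up to `n ≤ n_β + 1` gives the merged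
  export at every `j ≤ n`), **`levelsUExportMixedAt_klCU2_all_of_exists`** (the same from the ∃-statement `∃ e, IsExportPkg2 e ∧ LevelsUStep2 P R Q₀ e.1 e.2.2`
  — the (X).1 conjunct BYTE-VERBATIM — at the deferred table `klCU2 P R Q₀` below the deferred threshold `klCUu2 P R Q₀ Q cc`), and the thin corollary
  `levelsUExportAt_klCU2_all_of_exists`.

The K2 composition feeds §1 with `G := klEngGeo8`, `Q := QT P R` (`hQ := isRaiseOf_klEngQ8 P R` at table (Q8); `isRaiseOf_klEngQ9` at the freeze),
`U ≤ klEngU₀10` / `U ≤ klCUu2 …` from the DefsU11 rows, `h0 := klFrameOK_zeroC …`.  Classes #6/#5 [#7] get the same 5-line instantiation the day their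
successor modules land.  Proofs only; no definitions; nothing here asserts that any step Prop holds; nothing asserts superconductivity.
References: BGM 2006 §2.4–§3 [cite: BenfattoGiulianiMastropietro2006].
-/

noncomputable section

namespace Summit.HubbardSuperconductivity.HubbardSuperconductivity.Theorems.EngineV8

set_option linter.dupNamespace false -- summit = problem name (single-conjunct summit), D-0017

open Real Finset Literature.MathematicalPhysics.QuantumLattice Literature.Probability.LatticeModels
open Literature.MathematicalPhysics.QuantumLattice.FermiRG
open Summit.HubbardSuperconductivity.HubbardSuperconductivity.Theorems.KLProgrammeLegKernels
open Summit.HubbardSuperconductivity.HubbardSuperconductivity.Theorems.DispersionFlow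
open Summit.HubbardSuperconductivity.HubbardSuperconductivity.Theorems.KLRegimeSplit

/-! ## §0 The generic strong-induction unroll (K2) -/

/-- **Generic strong-induction unroll**: a one-step statement with history, valid at every scale `n ≤ N`, gives the export at every `j ≤ n ≤ N`.
(Text of plan g19's v2x prerender §0.) -/
theorem exports_all_of_step {E : ℕ → Prop} {N : ℕ} (h : ∀ n ≤ N, (∀ j < n, E j) → E n) : ∀ n ≤ N, ∀ j ≤ n, E j := by
  intro n
  induction n using Nat.strong_induction_on with
  | _ n ih =>
    intro hn j hj
    rcases hj.lt_or_eq with hlt | rfl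
    · exact ih j hlt (by omega) j le_rfl
    · exact h j hn fun i hi => ih i hi (by omega) i le_rfl

/-- **Two-history variant**: with a class-#1-type export `E` already known at every `j ≤ N`, a one-step statement for `F` reading `E` at `j ≤ n` and
its own history at `j < n` gives `F` at every `j ≤ n ≤ N` (classes #5/#6). -/
theorem exports_all_of_step₂ {E F : ℕ → Prop} {N : ℕ} (hE : ∀ j ≤ N, E j) (h : ∀ n ≤ N, (∀ j ≤ n, E j) → (∀ j < n, F j) → F n) :
    ∀ n ≤ N, ∀ j ≤ n, F j :=
  exports_all_of_step fun n hn hist => h n hn (fun j hj => hE j (hj.trans hn)) hist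

/-! ## §1 Class #1, successor shape (`LevelsUStep2`, merged exports `LevelsUExportMixedAt`) -/

section Unroll2

variable {P : SplitConsts} {R : RenConsts} {Q₀ Q : EngConsts} {G : GeoConsts} {cc μ U β : ℝ} {L M : ℕ} [NeZero L] [NeZero M]

/-- **CLASS #1 UNROLLED, successor shape**: from `LevelsUStep2 P R Q₀ c u`, a geometry package `G` (`G.WF`), a raise `Q` of the key package `Q₀`, the
v2 binders (`0 < cc ≤ klEngC₃6`, `μ ∈ klWindowC`, `0 < U ≤ klEngU₀10 P R cc`, `U ≤ u Q cc`, `klBetaMin ≤ β ≤ e^{cc/U²}`, `klEngL₄ P R β U ≤ L`, `klEngM₃ β U L ≤ M`),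
the bare frame's admissibility `h0` and `R.WF2`: the public history up to `n ≤ n_β + 1` gives the merged export at EVERY `j ≤ n` (regime at every
`j ≤ n_β + 1` by `isKLRegime_of_le_nScales_succ`, frames by `frameOK_klFlowFrameU_of_histP`, histories by restriction). -/
theorem levelsUExportMixedAt_all_of_step2 {c : ℕ → ℝ} {u : EngConsts → ℝ → ℝ} (hstep : LevelsUStep2 P R Q₀ c u) (hG : G.WF) (hQ : Q₀.IsRaiseOf Q)
    (hcc0 : 0 < cc) (hcc : cc ≤ klEngC₃6 P R) (hμ : μ ∈ klWindowC) (h0 : FrameOK R U (nScales β) μ 0) (hU : 0 < U) (hU10 : U ≤ klEngU₀10 P R cc)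
    (hUu : U ≤ u Q cc) (hβ : klBetaMin ≤ β) (hβc : β ≤ Real.exp (cc / U ^ 2)) (hL : klEngL₄ P R β U ≤ L) (hM : klEngM₃ β U L ≤ M) (hR : R.WF2)
    {n : ℕ} (hn : n ≤ nScales β + 1) (hhist : HistP klPredsV17F2 L M G P Q R β U μ 0 n) :
    ∀ j ≤ n, LevelsUExportMixedAt L M c P β U μ j :=
  exports_all_of_step (E := fun j => LevelsUExportMixedAt L M c P β U μ j) (N := n)
    (fun m hm hist => by
      have hmn : m ≤ nScales β + 1 := hm.trans hn
      have hhm : HistP klPredsV17F2 L M G P Q R β U μ 0 m := histP_klPredsV17F2_of_le hhist hm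
      exact hstep G hG Q hQ cc hcc0 hcc μ hμ U hU hU10 hUu β hβ hβc L M hL hM m hmn (isKLRegime_of_le_nScales_succ hcc0.le hβ hβc hmn) hhm
        (frameOK_klFlowFrameU_of_histP hR h0 hmn hhm) hist)
    n le_rfl

/-- **CLASS #1 AT THE DEFERRED TABLE, from the existence statement** — the (X).1 conjunct of `stub_engine_exports` byte-verbatim
(`∃ e, IsExportPkg2 e ∧ LevelsUStep2 P R Q₀ e.1 e.2.2`): below the deferred threshold `klCUu2 P R Q₀ Q cc`, the merged exports at the table `klCU2 P R Q₀`
at every `j ≤ n`. -/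
theorem levelsUExportMixedAt_klCU2_all_of_exists
    (hex : ∃ e : (ℕ → ℝ) × ℝ × (EngConsts → ℝ → ℝ), IsExportPkg2 e ∧ LevelsUStep2 P R Q₀ e.1 e.2.2) (hG : G.WF) (hQ : Q₀.IsRaiseOf Q)
    (hcc0 : 0 < cc) (hcc : cc ≤ klEngC₃6 P R) (hμ : μ ∈ klWindowC) (h0 : FrameOK R U (nScales β) μ 0) (hU : 0 < U) (hU10 : U ≤ klEngU₀10 P R cc)
    (hUu : U ≤ klCUu2 P R Q₀ Q cc) (hβ : klBetaMin ≤ β) (hβc : β ≤ Real.exp (cc / U ^ 2)) (hL : klEngL₄ P R β U ≤ L) (hM : klEngM₃ β U L ≤ M)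
    (hR : R.WF2) {n : ℕ} (hn : n ≤ nScales β + 1) (hhist : HistP klPredsV17F2 L M G P Q R β U μ 0 n) :
    ∀ j ≤ n, LevelsUExportMixedAt L M (klCU2 P R Q₀) P β U μ j :=
  levelsUExportMixedAt_all_of_step2 (levelsUStep2_klCU2_of_exists hex) hG hQ hcc0 hcc hμ h0 hU hU10 hUu hβ hβc hL hM hR hn hhist

/-- Thin corollary: the same hypotheses give the THIN exports `LevelsUExportAt` at the successor table `klCU2 P R Q₀` at every `j ≤ n`
(`LevelsUExportMixedAt.toLevelsUExportAt`). -/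
theorem levelsUExportAt_klCU2_all_of_exists
    (hex : ∃ e : (ℕ → ℝ) × ℝ × (EngConsts → ℝ → ℝ), IsExportPkg2 e ∧ LevelsUStep2 P R Q₀ e.1 e.2.2) (hG : G.WF) (hQ : Q₀.IsRaiseOf Q)
    (hcc0 : 0 < cc) (hcc : cc ≤ klEngC₃6 P R) (hμ : μ ∈ klWindowC) (h0 : FrameOK R U (nScales β) μ 0) (hU : 0 < U) (hU10 : U ≤ klEngU₀10 P R cc)
    (hUu : U ≤ klCUu2 P R Q₀ Q cc) (hβ : klBetaMin ≤ β) (hβc : β ≤ Real.exp (cc / U ^ 2)) (hL : klEngL₄ P R β U ≤ L) (hM : klEngM₃ β U L ≤ M)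
    (hR : R.WF2) {n : ℕ} (hn : n ≤ nScales β + 1) (hhist : HistP klPredsV17F2 L M G P Q R β U μ 0 n) :
    ∀ j ≤ n, LevelsUExportAt L M (klCU2 P R Q₀) P β U μ j :=
  fun j hj => (levelsUExportMixedAt_klCU2_all_of_exists hex hG hQ hcc0 hcc hμ h0 hU hU10 hUu hβ hβc hL hM hR hn hhist j hj).toLevelsUExportAt

end Unroll2

end Summit.HubbardSuperconductivity.HubbardSuperconductivity.Theorems.EngineV8

end
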